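import Summits.CriticalPhenomena.PercolationContinuityZ3.Theorems.FK.Transplant.KNFreePinningLawFK
import Summits.CriticalPhenomena.PercolationContinuityZ3.Theorems.FK.Transplant.FHBernoulliWindow

/-!
# KN (26) for `fkLaw`, q ≥ 1: the exchange inequality — KERNEL FACT OF RECORD for row 2 (CHAIN-MAP §D/§H(7))

Builds on p205010 (kernel theorem, internal audit signed; external expert review pending). **CONDITIONAL
sub-cell (FH AND TP_FK open at the same p for q > 1; ⇔ GRC Conj. (5.103) via K1); the transplant
(`ufsc0_of_freeBoundaryHypothesis_r3`) is a typed reduction, not a proof of FK continuity.** Barrier note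
cited first (FBN-01): `Literature.Barriers.CriticalPhenomena.SamePFreeBoundaryCriteria` (theorem
`samePFreeBoundaryCriteria`, named fact `Bodineau2005_slabThreshold`; cited by name, not imported).
Calibration K1, verbatim: "[C3a ∀ p > p_c(q)] ∧ C3b ⇒ p̂_c(q) = p_c(q) = GRC Conj (5.103) = DT Question 5
(open for q ∈ (1,2))". KERNEL FACT OF RECORD for row 2 (`h_tgt : KNFreeTargetHittable d q p`), CHAIN-MAP
§D/§H(7) (lead ruling L12, registry item T2a): NOT a binder discharge, NOT `_r4`, no information at
`p ↓ p_c(q)`; record `_r3` p248245 « 2 / 0 ☑ » unchanged, n_open = 2; registered R54 (cell INBOX,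
2026-08-22). 0 defs, 3 theorems; D1-clean (`fkLaw Λ W' 1`, no `prodBernoulli`).

The ONE step of Kozma–Nitzan's Lemma 10 (Step V, p. 21) that uses `q = 1` — the independence
`P_{K_ξ}(F_P) = P_G(F_P)` (26) between the first-open-seed event `F_P` (determined by the OFF-shell pairs `F`)
and the shell event `Ξ_P` — becomes for `fkLaw Λ W q`, `q ≥ 1`, the EXCHANGE INEQUALITY

  `φ_W(Ξᶜ ∩ F_P) ≤ φ_{pinW W F ∅}(Ξᶜ) · φ_W(F_P)`   (`Ξᶜ` decreasing),

i.e. the worst boundary condition for a decreasing event across the conditioned pairs is the FREE one (all of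
`F` pinned closed): a corollary of the landed pinning API (`isPinningLaw_fkLaw`; conditioning = pinning,
Grimmett Thm. (3.7)) and of monotonicity in the edge weights (`IsPinningLaw.real_anti_of_isLowerSet`). The
second theorem bounds the free-pinned decreasing event by the `q = 1` law of the (3.23) comparison weighting
(`fkLaw_real_ratio_one_le`, T1 `FHBernoulliWindow.lean`), where a Bernoulli(`p̃`) estimate,
`p̃ = p/(p+q(1-p))`, can enter; the third composes the two. Page numbers in the cite tags are book pages.

References: G. Kozma, S. Nitzan, arXiv:2401.12397 (2024), §4 Lemma 10, Step V, p. 21 ((26)) [KozmaNitzan2024];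
G. Grimmett, *The Random-Cluster Model*, Springer 2006, Thm. (3.7) (p. 39), Thm. (3.21), eqs. (3.22)–(3.23),
Conj. (5.103) [Grimmett2006].
-/

noncomputable section

open MeasureTheory
open scoped ENNReal Classical

namespace Summit.CriticalPhenomena.PercolationContinuityZ3.Theorems.FK

open Literature.Probability.Percolation Literature.Probability.LatticeModels SimpleGraph
open Literature.Probability.Percolation.KozmaNitzan Transplant

variable {d : ℕ}

/-- **KN (26) for `fkLaw`, `q ≥ 1` — the exchange inequality with the free pinning as worst boundary
condition.** For a finite set `F` of pairs of `Λ`, an event `B'` determined by `F` and a DECREASING measurable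
event `Ξc`: `φ_W(Ξc ∩ B') ≤ φ_{pinW W F ∅}(Ξc) · φ_W(B')` — conditioning on a pattern `T ⊆ F` is pinning
(Grimmett Thm. (3.7)), and `pinW W F ∅ ≤ pinW W F T` pointwise, so the all-closed pinning maximises decreasing
events (3.22). At `q = 1` both sides agree with KN's `P_{K_ξ}(F_P) = P_G(F_P)` read as an inequality.
[cite: KozmaNitzan2024, §4 p. 21 ((26)); Grimmett2006, Thm. (3.7) (p. 39), eq. (3.22)] -/
theorem fkLaw_real_inter_le_pinW_empty_of_isLowerSet (Λ : Finset (Site d)) {q : ℝ} (hq : 1 ≤ q)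
    (W : Sym2 (Site d) → unitInterval) {F : Finset (Sym2 (Site d))}
    (hF : (↑F : Set (Sym2 (Site d))) ⊆ Set.range (Sym2.map (Subtype.val : ↥Λ → Site d)))
    {Ξc B' : Set (BondConfig (Site d))} (hΞ : IsLowerSet Ξc) (hΞm : MeasurableSet Ξc)
    (hB' : DeterminedBy B' (↑F : Set (Sym2 (Site d)))) :
    (fkLaw Λ W q).real (Ξc ∩ B') ≤ (fkLaw Λ (pinW W ↑F ∅) q).real Ξc * (fkLaw Λ W q).real B' := by
  have hL := isPinningLaw_fkLaw Λ hq
  refine hL.real_inter_le_of_pinW_le W hF hΞm hB' fun T _ _ => ?_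
  exact hL.real_anti_of_isLowerSet (W := pinW W ↑F ∅) (W' := pinW W ↑F ↑T)
    (fun e _ => pinW_le_pinW_of_subset W (by simp) e) hΞ hΞm

/-- **Decreasing events under `fkLaw`, `q ≥ 1`, are bounded by the `q = 1` law of the (3.23) comparison
weighting**: if `W'(e)·q·(1 - W(e)) ≤ W(e)·(1 - W'(e))` on the pairs of `Λ` then
`φ_{W,q}(D) ≤ P_{W'}(D)` for decreasing measurable `D` (complement form of `fkLaw_real_ratio_one_le`).
With `W = pinW (subbox weighting) F ∅` and `W'` its image `w ↦ w/(w+q(1-w))` (`1 ↦ 1`, `0 ↦ 0`, `p ↦ p̃`) this is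
the entry point of a Bernoulli(`p̃`) Peierls estimate for the free-pinned shell event of the previous theorem.
[cite: Grimmett2006, Thm. (3.21), eq. (3.23)] -/
theorem fkLaw_real_le_ratio_one_of_isLowerSet (Λ : Finset (Site d)) {W W' : Sym2 (Site d) → unitInterval}
    {q : ℝ} (hq : 1 ≤ q)
    (hcond : ∀ x ∈ Λ, ∀ y ∈ Λ,
      (W' s(x, y) : ℝ) * (q * (1 - W s(x, y))) ≤ (W s(x, y) : ℝ) * (1 * (1 - W' s(x, y))))
    {D : Set (BondConfig (Site d))} (hD : IsLowerSet D) (hDm : MeasurableSet D) :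
    (fkLaw Λ W q).real D ≤ (fkLaw Λ W' 1).real D := by
  haveI : IsProbabilityMeasure (fkLaw Λ W q) := (isPinningLaw_fkLaw Λ hq).prob W
  haveI : IsProbabilityMeasure (fkLaw Λ W' 1) := (isPinningLaw_fkLaw Λ le_rfl).prob W'
  have h := fkLaw_real_ratio_one_le Λ hq hcond hD.compl hDm.compl
  rw [measureReal_compl hDm, measureReal_compl hDm, probReal_univ, probReal_univ] at h
  linarith

/-- **The two steps composed** (shape used by design (G) at high density): for `q ≥ 1`, `F` finite pairs of `Λ`,
`B'` determined by `F`, `Ξc` decreasing measurable, and any weighting `W'` that is (3.23)-below the free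
pinning `pinW W F ∅` on `Λ`: `φ_W(Ξc ∩ B') ≤ P_{W'}(Ξc) · φ_W(B')`.
[cite: KozmaNitzan2024, §4 p. 21 ((26)); Grimmett2006, Thm. (3.7), Thm. (3.21) eq. (3.23)] -/
theorem fkLaw_real_inter_le_ratio_one_mul (Λ : Finset (Site d)) {q : ℝ} (hq : 1 ≤ q)
    (W W' : Sym2 (Site d) → unitInterval) {F : Finset (Sym2 (Site d))}
    (hF : (↑F : Set (Sym2 (Site d))) ⊆ Set.range (Sym2.map (Subtype.val : ↥Λ → Site d)))
    (hcond : ∀ x ∈ Λ, ∀ y ∈ Λ,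
      (W' s(x, y) : ℝ) * (q * (1 - pinW W ↑F ∅ s(x, y))) ≤
        (pinW W ↑F ∅ s(x, y) : ℝ) * (1 * (1 - W' s(x, y))))
    {Ξc B' : Set (BondConfig (Site d))} (hΞ : IsLowerSet Ξc) (hΞm : MeasurableSet Ξc)
    (hB' : DeterminedBy B' (↑F : Set (Sym2 (Site d)))) :
    (fkLaw Λ W q).real (Ξc ∩ B') ≤ (fkLaw Λ W' 1).real Ξc * (fkLaw Λ W q).real B' :=
  (fkLaw_real_inter_le_pinW_empty_of_isLowerSet Λ hq W hF hΞ hΞm hB').trans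
    (mul_le_mul_of_nonneg_right (fkLaw_real_le_ratio_one_of_isLowerSet Λ hq hcond hΞ hΞm)
      measureReal_nonneg)

end Summit.CriticalPhenomena.PercolationContinuityZ3.Theorems.FK

end
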